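import Literature.AnabelianGeometry.SemiGraphs.CechNerveFunctor
import Literature.AnabelianGeometry.SemiGraphs.BTempCechToolkit
import Literature.AnabelianGeometry.SemiGraphs.BTempCoequalizerPoints
import Literature.AnabelianGeometry.SemiGraphs.ThmA4CechPresentation
import Literature.AnabelianGeometry.SemiGraphs.BTempLimitsProofs
import Mathlib.CategoryTheory.Limits.Constructions.LimitsOfProductsAndEqualizers
import Mathlib.CategoryTheory.Limits.Preserves.Shapes.Pullbacks
import Mathlib.CategoryTheory.Limits.Preserves.Shapes.BinaryProducts
import Mathlib.CategoryTheory.Limits.Preserves.Shapes.Terminal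
import Mathlib.CategoryTheory.Limits.Constructions.EpiMono
import HarnessLib

/-!
# Semi-graphs of anabelioids, Appendix, Theorem A.4 (Čech route): the Čech extension
# `ψ^*(X) := coeq(H((X ⨯ A) ⨯ A) ⇉ H(X ⨯ A))` — points of `ψ^*(X)` (part 1 of 2)

Mochizuki, *Semi-graphs of anabelioids*, Publ. RIMS **42** (2006) 221–322, Appendix, Theorem A.4
(manuscript pp. 82–86; the printed proof's clause "Thus, to show that `ψ` is a morphism of temperoids
[i.e., that `ψ^*` preserves finite limits], it suffices to show that `ψ^*` preserves terminal
objects", p. 85, and the "routine argument" for fibre products) [cite: MochizukiSemiAnbd2006, Thm A.4 pp.82-86].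
Row A4-∃ / file E3 (part 1) of `plan/L3/SUBDAG-SemiAnbd-Cor311.md` (holder abc-iut-w5-d129; seat map
2026-08-26T03:40Z).  SETTING: `T₂ = B^temp(Π₂)`, `A₂ ∈ T₂`, `H : T₂[A₂] ⥤ B^temp(Π₁)` a functor
preserving limits of shape cospan and binary-product shape (in the application `H = φ^* ⋙ ι₁` with
`φ^*` left exact and `ι₁ : T₁[A₁] ⊆ T₁` preserving nonempty-shape limits), and the Čech extension

  `CechSq.cechExt A₂ H := (CechSq.nerve A₂ ⋙ (− ⋙ H)) ⋙ colim : T₂ ⥤ B^temp(Π₁)`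

(= `P.extension H` of `ThmA4CechPresentation.lean` for any presentation `P` whose nerve is
`CechSq.nerve A₂`).  RESULTS (all ON POINTS in `B^temp(Π₁)`):

* §1 transport: `H` carries the pullback squares / binary fans of the nerve (`CechNerveSquares.lean`,
  limits of NONEMPTY shape among objects of `T₂[A₂]`, hence limits in `T₂[A₂]`) to limit cones;
* §2 the image relation `R_X := {(H k₁ w, H k₂ w)}` on the points of `H(X ⨯ A₂)` is an EQUIVALENCE
  RELATION (`pairRel_equivalence`: reflexive by `δ`, symmetric by `σ`, transitive by the square
  `((X⨯A)⨯A)⨯A = K ×_P K`), so `ψ^*(X)` = points of `H(X ⨯ A₂)` modulo `R_X` in ONE step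
  (`π_apply_eq_iff`, `π_surjective` — via `BTempCoequalizerPoints.lean`);
* §3 naturality of `H k₁, H k₂` on points and the joint injectivity of `(H k₁, H k₂)` (`KH_ext`,
  from the monomorphism `(k₁, k₂)` and the product `P ⨯ P`).

Part 2 (`QuasiTemperoidsThmA4CechLimits.lean`): terminal object, pullbacks, `PreservesFiniteLimits`.

Nothing here takes a side on [IUTchIII] Cor. 3.12; typed ≠ proved elsewhere, PROVED here.
-/

open CategoryTheory CategoryTheory.Limits

noncomputable section

namespace Literature.AnabelianGeometry.SemiGraphs

namespace CechSq

open WalkingParallelPair WalkingParallelPairHom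

universe u

variable {G₁ : Type u} [Group G₁] [TopologicalSpace G₁] [IsTopologicalGroup G₁]
  {G₂ : Type u} [Group G₂] [TopologicalSpace G₂]
  [HasFiniteLimits (BTemp G₂)] [HasFiniteLimits (BTemp G₁)]
  [HasColimitsOfShape WalkingParallelPair (BTemp G₁)]
  (A : BTemp G₂) (H : Over' A ⥤ BTemp G₁)

/-- **The Čech extension** `ψ^*(X) := colim H(nerve X) = coeq(H((X ⨯ A) ⨯ A) ⇉ H(X ⨯ A))`, as a
functor `B^temp(Π₂) ⥤ B^temp(Π₁)` (the `extension` of `ThmA4CechPresentation.lean` along the nerve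
`CechSq.nerve A`). [cite: MochizukiSemiAnbd2006, Thm A.4 pp.82-86] -/
def cechExt : BTemp G₂ ⥤ BTemp G₁ :=
  (nerve A ⋙ (Functor.whiskeringRight WalkingParallelPair (Over' A) (BTemp G₁)).obj H) ⋙ colim

/-- The image pair `H((X ⨯ A) ⨯ A) ⇉ H(X ⨯ A)` as a diagram. [cite: MochizukiSemiAnbd2006, Thm A.4 pp.82-86] -/
abbrev D (X : BTemp G₂) : WalkingParallelPair ⥤ BTemp G₁ := (nerve A).obj X ⋙ H

/-- `H(k₁)`. [cite: MochizukiSemiAnbd2006, Thm A.4 pp.82-86] -/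
abbrev e₁ (X : BTemp G₂) : H.obj (KOver A X) ⟶ H.obj (POver A X) := H.map (k₁Over A X)

/-- `H(k₂)`. [cite: MochizukiSemiAnbd2006, Thm A.4 pp.82-86] -/
abbrev e₂ (X : BTemp G₂) : H.obj (KOver A X) ⟶ H.obj (POver A X) := H.map (k₂Over A X)

/-- The structure map `π_X : H(X ⨯ A) → ψ^*(X)`. [cite: MochizukiSemiAnbd2006, Thm A.4 pp.82-86] -/
abbrev π (X : BTemp G₂) : H.obj (POver A X) ⟶ (cechExt A H).obj X := colimit.ι (D A H X) one

omit [IsTopologicalGroup G₁] [HasFiniteLimits (BTemp G₁)] in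
/-- `ψ^*(X) = colim H(nerve X)`. [cite: MochizukiSemiAnbd2006, Thm A.4 pp.82-86] -/
theorem cechExt_obj (X : BTemp G₂) : (cechExt A H).obj X = colimit (D A H X) := rfl

omit [IsTopologicalGroup G₁] [HasFiniteLimits (BTemp G₁)] in
/-- `π` coequalizes `H k₁, H k₂`. [cite: MochizukiSemiAnbd2006, Thm A.4 pp.82-86] -/
theorem π_condition (X : BTemp G₂) : e₁ A H X ≫ π A H X = e₂ A H X ≫ π A H X :=
  ThmA4Cech.colimit_ι_one_condition (D A H X)

omit [IsTopologicalGroup G₁] [HasFiniteLimits (BTemp G₁)] in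
/-- `π_X : H(X ⨯ A) → ψ^*(X)` is a colimit cofork of `(H k₁, H k₂)`. [cite: MochizukiSemiAnbd2006, Thm A.4 pp.82-86] -/
def πIsColimit (X : BTemp G₂) :
    IsColimit (Cofork.ofπ (π A H X) (π_condition A H X) : Cofork (e₁ A H X) (e₂ A H X)) :=
  ThmA4Cech.colimitCoforkIsColimit (D A H X)

omit [IsTopologicalGroup G₁] [HasFiniteLimits (BTemp G₁)] in
/-- `ψ^*` on arrows against `π`: `ψ^*(f) (π_X y) = π_Y (H(f ⨯ A) y)`. [cite: MochizukiSemiAnbd2006, Thm A.4 pp.82-86] -/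
theorem cechExt_map_π_apply {X Y : BTemp G₂} (f : X ⟶ Y) (y : (H.obj (POver A X)).obj.V) :
    (((cechExt A H).map f).hom.hom ((π A H X).hom.hom y) : ((cechExt A H).obj Y).obj.V) =
      (π A H Y).hom.hom ((H.map (ObjectProperty.homMk (mapP A f) : POver A X ⟶ POver A Y)).hom.hom y) := by
  have h : π A H X ≫ (cechExt A H).map f =
      H.map (ObjectProperty.homMk (mapP A f) : POver A X ⟶ POver A Y) ≫ π A H Y :=
    ι_colimMap (Functor.whiskerRight ((nerve A).map f) H) one
  exact congrArg (fun φ => (φ.hom.hom y : ((cechExt A H).obj Y).obj.V)) h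


/-! ### §1 Transport of the nerve's limit cones through `H` -/

section Transport

variable [PreservesLimitsOfShape WalkingCospan H] [PreservesLimitsOfShape (Discrete WalkingPair) H]

omit [IsTopologicalGroup G₁] [HasFiniteLimits (BTemp G₁)]
  [HasColimitsOfShape WalkingParallelPair (BTemp G₁)] [PreservesLimitsOfShape (Discrete WalkingPair) H] in
/-- **Transport of pullback squares**: a commutative square of `T₂[A₂]` whose underlying square in
`B^temp(Π₂)` is a pullback is a pullback in `T₂[A₂]` (the inclusion reflects limits), hence is carried
by `H` to a pullback square of `B^temp(Π₁)`. [cite: MochizukiSemiAnbd2006, Thm A.4 pp.82-86] -/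
def isLimitMapSq {W X Y Z : Over' A} {f : X ⟶ Z} {g : Y ⟶ Z} {a : W ⟶ X} {b : W ⟶ Y}
    (comm : a ≫ f = b ≫ g)
    (h : IsLimit (PullbackCone.mk a.hom b.hom (congrArg (fun φ => φ.hom) comm) :
      PullbackCone f.hom g.hom)) :
    IsLimit (PullbackCone.mk (H.map a) (H.map b)
      (show H.map a ≫ H.map f = H.map b ≫ H.map g by rw [← H.map_comp, comm, H.map_comp]) :
      PullbackCone (H.map f) (H.map g)) :=
  isLimitPullbackConeMapOfIsLimit H comm
    (isLimitOfIsLimitPullbackConeMap (admitsHomTo A).ι comm h)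

omit [IsTopologicalGroup G₁] [HasFiniteLimits (BTemp G₁)]
  [HasColimitsOfShape WalkingParallelPair (BTemp G₁)] [PreservesLimitsOfShape WalkingCospan H] in
/-- **Transport of binary products**: a binary fan of `T₂[A₂]` whose underlying fan is a product in
`B^temp(Π₂)` is carried by `H` to a product fan of `B^temp(Π₁)`. [cite: MochizukiSemiAnbd2006, Thm A.4 pp.82-86] -/
def isLimitMapFan {W X Y : Over' A} (a : W ⟶ X) (b : W ⟶ Y)
    (h : IsLimit (BinaryFan.mk a.hom b.hom)) :
    IsLimit (BinaryFan.mk (H.map a) (H.map b)) :=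
  mapIsLimitOfPreservesOfIsLimit H a b (isLimitOfReflectsOfMapIsLimit (admitsHomTo A).ι a b h)

end Transport

/-! ### §2 The image relation is an equivalence relation; points of `ψ^*(X)` -/

section Relation

/-- `((X ⨯ A) ⨯ A) ⨯ A` as an object of `T₂[A₂]`. [cite: MochizukiSemiAnbd2006, Thm A.4 pp.82-86] -/
abbrev KKOver (X : BTemp G₂) : Over' A := (OverPrime.prodA A).obj ((X ⨯ A) ⨯ A)

variable [PreservesLimitsOfShape WalkingCospan H]

omit [IsTopologicalGroup G₁] [HasFiniteLimits (BTemp G₁)]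
  [HasColimitsOfShape WalkingParallelPair (BTemp G₁)] in
/-- **The image relation `R_X = {(H k₁ w, H k₂ w)}` on the points of `H(X ⨯ A)` is an equivalence
relation** — reflexive via the diagonal `δ`, symmetric via the swap `σ`, transitive because `H` carries
the pullback `((X⨯A)⨯A)⨯A = K ×_{k₂, P, k₁} K` to a pullback. [cite: MochizukiSemiAnbd2006, Thm A.4 pp.82-86] -/
theorem pairRel_equivalence (X : BTemp G₂) : Equivalence (BTemp.PairRel (e₁ A H X) (e₂ A H X)) where
  refl y := by
    refine ⟨(H.map (ObjectProperty.homMk (δ A X) : POver A X ⟶ KOver A X)).hom.hom y, ?_, ?_⟩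
    · change ((H.map (ObjectProperty.homMk (δ A X) : POver A X ⟶ KOver A X) ≫ H.map (k₁Over A X)).hom.hom y
        : (H.obj (POver A X)).obj.V) = y
      rw [← H.map_comp]
      have : (ObjectProperty.homMk (δ A X) : POver A X ⟶ KOver A X) ≫ k₁Over A X = 𝟙 _ :=
        ObjectProperty.hom_ext _ (δ_k₁ A X)
      rw [this, H.map_id]
      rfl
    · change ((H.map (ObjectProperty.homMk (δ A X) : POver A X ⟶ KOver A X) ≫ H.map (k₂Over A X)).hom.hom y
        : (H.obj (POver A X)).obj.V) = y
      rw [← H.map_comp]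
      have : (ObjectProperty.homMk (δ A X) : POver A X ⟶ KOver A X) ≫ k₂Over A X = 𝟙 _ :=
        ObjectProperty.hom_ext _ (δ_k₂ A X)
      rw [this, H.map_id]
      rfl
  symm := by
    rintro y y' ⟨w, rfl, rfl⟩
    refine ⟨(H.map (ObjectProperty.homMk (σ A X) : KOver A X ⟶ KOver A X)).hom.hom w, ?_, ?_⟩
    · change ((H.map (ObjectProperty.homMk (σ A X) : KOver A X ⟶ KOver A X) ≫ H.map (k₁Over A X)).hom.hom w
        : (H.obj (POver A X)).obj.V) = _
      rw [← H.map_comp]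
      have : (ObjectProperty.homMk (σ A X) : KOver A X ⟶ KOver A X) ≫ k₁Over A X = k₂Over A X :=
        ObjectProperty.hom_ext _ (σ_k₁ A X)
      rw [this]
    · change ((H.map (ObjectProperty.homMk (σ A X) : KOver A X ⟶ KOver A X) ≫ H.map (k₂Over A X)).hom.hom w
        : (H.obj (POver A X)).obj.V) = _
      rw [← H.map_comp]
      have : (ObjectProperty.homMk (σ A X) : KOver A X ⟶ KOver A X) ≫ k₂Over A X = k₁Over A X :=
        ObjectProperty.hom_ext _ (σ_k₂ A X)
      rw [this]
  trans := by
    rintro y y' y'' ⟨w, rfl, rfl⟩ ⟨w', hw', rfl⟩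
    -- the transitivity square `KK = K ×_{k₂, P, k₁} K`, carried by `H` to a pullback of `B^temp(Π₁)`
    let m₁O : KKOver A X ⟶ KOver A X := ObjectProperty.homMk (m₁ A X)
    let m₂O : KKOver A X ⟶ KOver A X := ObjectProperty.homMk (m₂ A X)
    let m₃O : KKOver A X ⟶ KOver A X := ObjectProperty.homMk (m₃ A X)
    have comm : m₁O ≫ k₂Over A X = m₂O ≫ k₁Over A X := ObjectProperty.hom_ext _ (m₁_k₂ A X)
    have hsq := isLimitMapSq A H comm (isLimit_trans A X)
    obtain ⟨t, ht₁, ht₂⟩ := BTemp.exists_point_of_isLimit_pullbackCone' hsq w w' hw'.symm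
    refine ⟨(H.map m₃O).hom.hom t, ?_, ?_⟩
    · change ((H.map m₃O ≫ H.map (k₁Over A X)).hom.hom t : (H.obj (POver A X)).obj.V) = _
      rw [← H.map_comp]
      have : m₃O ≫ k₁Over A X = m₁O ≫ k₁Over A X := ObjectProperty.hom_ext _ (m₃_k₁ A X)
      rw [this, H.map_comp]
      exact congrArg (fun z => ((H.map (k₁Over A X)).hom.hom z : (H.obj (POver A X)).obj.V)) ht₁
    · change ((H.map m₃O ≫ H.map (k₂Over A X)).hom.hom t : (H.obj (POver A X)).obj.V) = _
      rw [← H.map_comp]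
      have : m₃O ≫ k₂Over A X = m₂O ≫ k₂Over A X := ObjectProperty.hom_ext _ (m₃_k₂ A X)
      rw [this, H.map_comp]
      exact congrArg (fun z => ((H.map (k₂Over A X)).hom.hom z : (H.obj (POver A X)).obj.V)) ht₂

omit [HasFiniteLimits (BTemp G₁)] in
/-- **Points of `ψ^*(X)`, injectivity side**: `π_X y = π_X y′ ↔ (y, y′) ∈ R_X` — ONE step, no chains.
[cite: MochizukiSemiAnbd2006, Thm A.4 pp.82-86] -/
theorem π_apply_eq_iff (X : BTemp G₂) {y y' : (H.obj (POver A X)).obj.V} :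
    ((π A H X).hom.hom y : ((cechExt A H).obj X).obj.V) = (π A H X).hom.hom y' ↔
      BTemp.PairRel (e₁ A H X) (e₂ A H X) y y' :=
  BTemp.cofork_π_apply_eq_iff_of_equivalence (π_condition A H X) (πIsColimit A H X)
    (pairRel_equivalence A H X)

omit [HasFiniteLimits (BTemp G₁)] [PreservesLimitsOfShape WalkingCospan H] in
/-- **Points of `ψ^*(X)`, surjectivity side**: every point of `ψ^*(X)` is `π_X y` for a point `y` of
`H(X ⨯ A)`. [cite: MochizukiSemiAnbd2006, Thm A.4 pp.82-86] -/
theorem π_surjective (X : BTemp G₂) :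
    Function.Surjective fun y : (H.obj (POver A X)).obj.V =>
      ((π A H X).hom.hom y : ((cechExt A H).obj X).obj.V) :=
  BTemp.cofork_π_surjective (π_condition A H X) (πIsColimit A H X)

end Relation


/-! ### §3 Naturality of the nerve maps under `H`, on points -/

section Naturality

omit [IsTopologicalGroup G₁] [HasFiniteLimits (BTemp G₁)] [HasColimitsOfShape WalkingParallelPair (BTemp G₁)] in
/-- Pointwise composition in `B^temp(Π)`. [cite: MochizukiSemiAnbd2006, Thm A.4 pp.82-86] -/
theorem comp_apply' {X Y Z : BTemp G₁} (φ : X ⟶ Y) (ψ : Y ⟶ Z) (x : X.obj.V) :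
    ((φ ≫ ψ).hom.hom x : Z.obj.V) = ψ.hom.hom (φ.hom.hom x) := rfl

/-- `H(u ⨯ A)`. [cite: MochizukiSemiAnbd2006, Thm A.4 pp.82-86] -/
abbrev HP {X Y : BTemp G₂} (u : X ⟶ Y) : H.obj (POver A X) ⟶ H.obj (POver A Y) :=
  H.map (ObjectProperty.homMk (mapP A u) : POver A X ⟶ POver A Y)

/-- `H((u ⨯ A) ⨯ A)`. [cite: MochizukiSemiAnbd2006, Thm A.4 pp.82-86] -/
abbrev HK {X Y : BTemp G₂} (u : X ⟶ Y) : H.obj (KOver A X) ⟶ H.obj (KOver A Y) :=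
  H.map (ObjectProperty.homMk (mapK A u) : KOver A X ⟶ KOver A Y)

omit [IsTopologicalGroup G₁] [HasFiniteLimits (BTemp G₁)]
  [HasColimitsOfShape WalkingParallelPair (BTemp G₁)] in
/-- `H k₁` is natural: `H k₁ (H(Ku) v) = H(Pu) (H k₁ v)`. [cite: MochizukiSemiAnbd2006, Thm A.4 pp.82-86] -/
theorem e₁_HK_apply {X Y : BTemp G₂} (u : X ⟶ Y) (v : (H.obj (KOver A X)).obj.V) :
    ((e₁ A H Y).hom.hom ((HK A H u).hom.hom v) : (H.obj (POver A Y)).obj.V) =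
      (HP A H u).hom.hom ((e₁ A H X).hom.hom v) := by
  rw [← comp_apply', ← comp_apply', ← H.map_comp, ← H.map_comp]
  have : (ObjectProperty.homMk (mapK A u) : KOver A X ⟶ KOver A Y) ≫ k₁Over A Y =
      k₁Over A X ≫ (ObjectProperty.homMk (mapP A u) : POver A X ⟶ POver A Y) :=
    ObjectProperty.hom_ext _ (mapK_k₁ A u)
  rw [this]

omit [IsTopologicalGroup G₁] [HasFiniteLimits (BTemp G₁)]
  [HasColimitsOfShape WalkingParallelPair (BTemp G₁)] in
/-- `H k₂` is natural: `H k₂ (H(Ku) v) = H(Pu) (H k₂ v)`. [cite: MochizukiSemiAnbd2006, Thm A.4 pp.82-86] -/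
theorem e₂_HK_apply {X Y : BTemp G₂} (u : X ⟶ Y) (v : (H.obj (KOver A X)).obj.V) :
    ((e₂ A H Y).hom.hom ((HK A H u).hom.hom v) : (H.obj (POver A Y)).obj.V) =
      (HP A H u).hom.hom ((e₂ A H X).hom.hom v) := by
  rw [← comp_apply', ← comp_apply', ← H.map_comp, ← H.map_comp]
  have : (ObjectProperty.homMk (mapK A u) : KOver A X ⟶ KOver A Y) ≫ k₂Over A Y =
      k₂Over A X ≫ (ObjectProperty.homMk (mapP A u) : POver A X ⟶ POver A Y) :=
    ObjectProperty.hom_ext _ (mapK_k₂ A u)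
  rw [this]

/-- `(X ⨯ A) ⨯ (X ⨯ A)` as an object of `T₂[A₂]`. [cite: MochizukiSemiAnbd2006, Thm A.4 pp.82-86] -/
abbrev PPOver (X : BTemp G₂) : Over' A := ⟨P A X ⨯ P A X, ⟨prod.snd ≫ prod.snd⟩⟩

/-- `(k₁, k₂)` as an arrow of `T₂[A₂]`. [cite: MochizukiSemiAnbd2006, Thm A.4 pp.82-86] -/
abbrev liftOver (X : BTemp G₂) : KOver A X ⟶ PPOver A X :=
  ObjectProperty.homMk (prod.lift (k₁ A X) (k₂ A X))

/-- The first projection `(X ⨯ A) ⨯ (X ⨯ A) → X ⨯ A` in `T₂[A₂]`. [cite: MochizukiSemiAnbd2006, Thm A.4 pp.82-86] -/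
abbrev fstOver (X : BTemp G₂) : PPOver A X ⟶ POver A X := ObjectProperty.homMk prod.fst

/-- The second projection in `T₂[A₂]`. [cite: MochizukiSemiAnbd2006, Thm A.4 pp.82-86] -/
abbrev sndOver (X : BTemp G₂) : PPOver A X ⟶ POver A X := ObjectProperty.homMk prod.snd

variable [PreservesLimitsOfShape WalkingCospan H] [PreservesLimitsOfShape (Discrete WalkingPair) H]

omit [IsTopologicalGroup G₁] [HasFiniteLimits (BTemp G₁)]
  [HasColimitsOfShape WalkingParallelPair (BTemp G₁)] in
/-- **`(H k₁, H k₂)` is jointly injective on the points of `H((X ⨯ A) ⨯ A)`** (`(k₁, k₂)` is a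
monomorphism into the product `(X ⨯ A) ⨯ (X ⨯ A)`, and `H` preserves both). [cite: MochizukiSemiAnbd2006, Thm A.4 pp.82-86] -/
theorem KH_ext (X : BTemp G₂) {v v' : (H.obj (KOver A X)).obj.V}
    (h₁ : ((e₁ A H X).hom.hom v : (H.obj (POver A X)).obj.V) = (e₁ A H X).hom.hom v')
    (h₂ : ((e₂ A H X).hom.hom v : (H.obj (POver A X)).obj.V) = (e₂ A H X).hom.hom v') : v = v' := by
  -- `(k₁, k₂)` is a mono of `T₂[A₂]`, `H` preserves monos, monos of `B^temp` are injective
  haveI : Mono ((admitsHomTo A).ι.map (liftOver A X)) := mono_lift_k₁_k₂ (A := A) X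
  haveI : Mono (liftOver A X) := (admitsHomTo A).ι.mono_of_mono_map inferInstance
  haveI : H.PreservesMonomorphisms := preservesMonomorphisms_of_preservesLimitsOfShape H
  have hinj := (BTemp.mono_iff_injective (H.map (liftOver A X))).mp inferInstance
  apply hinj
  -- and the points of `H((X ⨯ A) ⨯ (X ⨯ A))` are determined by the two projections
  have hfan := isLimitMapFan A H (fstOver A X) (sndOver A X) (prodIsProd (P A X) (P A X))
  apply BTemp.point_ext_of_isLimit_binaryFan hfan
  · rw [← comp_apply', ← comp_apply', ← H.map_comp]
    have : liftOver A X ≫ fstOver A X = k₁Over A X := ObjectProperty.hom_ext _ (prod.lift_fst _ _)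
    rw [this]
    exact h₁
  · rw [← comp_apply', ← comp_apply', ← H.map_comp]
    have : liftOver A X ≫ sndOver A X = k₂Over A X := ObjectProperty.hom_ext _ (prod.lift_snd _ _)
    rw [this]
    exact h₂

end Naturality

end CechSq

end Literature.AnabelianGeometry.SemiGraphs

end
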